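import Summits.Ventures.HSemireg.WedgeHankelRecurrenceGaussRecurrenceZeros

/-!
# Venture HSemireg — **THE FINITE FAVARD THEOREM**: for `q_0 = 1`, `q_1 = X − a_0`, `q_{n+2} = (X − a_{n+1}) q_{n+1} − b_{n+1} q_n` with all `b_j > 0` and any `m`, the zeros
# `z_0 < ⋯ < z_m` of `q_{m+1}` carry POSITIVE weights `μ_k` (`Σ μ_k = 1`) for which `q_0, …, q_m` are ORTHOGONAL: `Σ_k μ_k q_i(z_k) q_j(z_k) = δ_{ij} · b_1 ⋯ b_j` — every positive
# Jacobi recurrence is the recurrence of the orthogonal polynomials of a positive discrete measure (its `(m+1)`-point Gauss rule); DUAL ORTHOGONALITY from Christoffel–Darboux (N274)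
# and «`B Cᵀ = 1 ⇒ Cᵀ B = 1`» (`mul_eq_one_comm` for square matrices)

HONEST FRAMING. Part of the Lean index of the computation cell `pub-hsemireg` (seat p10 gen 42, Sunday typer «UNIFORM-IN-n»).  Real polynomials, finite sums and square real matrices only
(`mul_eq_one_comm`); no variety, no cohomology theory, no sheaf, no Ext group and no semiregularity map is constructed here; nothing here says that HC / HC_CM / HC_AV holds; no
Literature fact (unproved `Prop`) is declared or used.  Custodian versions as in `WedgeHankelSiegelIdeal` (1/3).
SOURCES (cited).  J. Favard, *Sur les polynômes de Tchebicheff*, C. R. Acad. Sci. Paris 200 (1935) 2052–2053; T. S. Chihara, *An Introduction to Orthogonal Polynomials* (1978), Ch. I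
Thm 4.4 (Favard) with Thm 4.2 (`L[P_n²] = λ_1 ⋯ λ_{n+1}`) and Ch. I §6 (Gauss quadrature (6.5)); G. Szegő, *Orthogonal Polynomials*, Thm 3.2.2 (Christoffel–Darboux) and (3.4.8); the
eigenvector orthogonality of the Jacobi matrix (G. H. Golub, J. H. Welsch, *Calculation of Gauss quadrature rules*, Math. Comp. 23 (1969) 221–230, §2).
PROOF TYPED HERE.  With `c_j = b_{j+1} ⋯ b_m`, Christoffel–Darboux at two distinct zeros `z_k ≠ z_l` of `q_{m+1}` gives `Σ_j c_j q_j(z_k) q_j(z_l) = 0`, and `K_k = Σ_j c_j q_j(z_k)² > 0`; the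
matrices `B_{kj} = c_j q_j(z_k)/K_k` and `C_{kj} = q_j(z_k)` satisfy `B Cᵀ = 1`, hence `Cᵀ B = 1`, i.e. `Σ_k q_i(z_k) c_j q_j(z_k)/K_k = δ_{ij}`; put `μ_k = c_0/K_k` and use
`c_0/c_j = b_1 ⋯ b_j`.
DEDUP DISCLOSURE (`rg -n 'favard|Favard|dual orthogonality' Summits/Ventures/HSemireg Literature`, 2026-09-02): nothing.  The 5 names below: 0 hits tree-wide.

WHAT IS IN THE TREE.  N274 `recurrence_christoffel_darboux`; N279 `recurrence_zeros_interlace`, `recurrence_monic_natDegree`; Mathlib `mul_eq_one_comm` (matrices), `Matrix.mul_apply`,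
`Matrix.one_apply`, `Fin.sum_univ_eq_sum_range`, `Finset.prod_Ico_consecutive`.
THIS FILE (namespace `Summit.Ventures.HSemireg.Wedge.HankelOuter` continued; CHAINED on N279; 0 definitions):
* §1045 `recurrence_cd_offdiag_eq_zero` (`Σ_j c_j q_j(z_k) q_j(z_l) = 0` for distinct zeros), `recurrence_cd_diag_pos` (`K_k > 0`), `recurrence_dual_orthogonality` (`Σ_k q_i(z_k) c_j q_j(z_k)/K_k = δ_{ij}`),
  `prod_Ico_one_div_prod_Ico_succ` (`c_0 = (b_1 ⋯ b_j) c_j`), **`favard_finite`** (THE FINITE FAVARD THEOREM: positive weights on the zeros of `q_{m+1}`, total mass `1`, orthogonality with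
  norms `b_1 ⋯ b_j`).
CAVEATS.  Finite sections only (the measure depends on `m`; the full Favard theorem is the projective limit); nothing Ext-side.  New names only.
-/

open Module Polynomial
open scoped Matrix Polynomial

namespace Summit.Ventures.HSemireg.Wedge.HankelOuter

/-! ## §1045. The finite Favard theorem -/

/-- **Off-diagonal Christoffel–Darboux at the zeros**: for distinct zeros `u ≠ v` of `q_{m+1}`, `Σ_{j ≤ m} (b_{j+1} ⋯ b_m) q_j(u) q_j(v) = 0`. [Szegő Thm 3.2.2; this file, §1045] -/
theorem recurrence_cd_offdiag_eq_zero {q : ℕ → ℝ[X]} {a b : ℕ → ℝ} (hq0 : q 0 = 1) (hq1 : q 1 = Polynomial.X - C (a 0))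
    (hrec : ∀ n, q (n + 2) = (Polynomial.X - C (a (n + 1))) * q (n + 1) - C (b (n + 1)) * q n) (m : ℕ) {u v : ℝ} (huv : u ≠ v)
    (hu : (q (m + 1)).eval u = 0) (hv : (q (m + 1)).eval v = 0) :
    ∑ j ∈ Finset.range (m + 1), (∏ l ∈ Finset.Ico (j + 1) (m + 1), b l) * ((q j).eval u * (q j).eval v) = 0 := by
  have h := recurrence_christoffel_darboux hq0 hq1 hrec m u v
  rw [hu, hv, zero_mul, mul_zero, sub_zero] at h
  rcases mul_eq_zero.1 h with h1 | h1
  · exact absurd (sub_eq_zero.1 h1) huv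
  · exact h1

/-- **Diagonal positivity**: `K(u) = Σ_{j ≤ m} (b_{j+1} ⋯ b_m) q_j(u)² > 0` for positive `b`. [mechanism; this file, §1045] -/
theorem recurrence_cd_diag_pos {q : ℕ → ℝ[X]} {b : ℕ → ℝ} (hq0 : q 0 = 1) (hb : ∀ j, 0 < b j) (m : ℕ) (u : ℝ) :
    0 < ∑ j ∈ Finset.range (m + 1), (∏ l ∈ Finset.Ico (j + 1) (m + 1), b l) * ((q j).eval u * (q j).eval u) := by
  have hnn : ∀ j ∈ Finset.range (m + 1), 0 ≤ (∏ l ∈ Finset.Ico (j + 1) (m + 1), b l) * ((q j).eval u * (q j).eval u) :=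
    fun j _ => mul_nonneg (Finset.prod_nonneg fun l _ => (hb l).le) (mul_self_nonneg _)
  refine lt_of_lt_of_le ?_ (Finset.single_le_sum hnn (Finset.mem_range.2 (Nat.succ_pos m)))
  rw [hq0, eval_one, mul_one, mul_one]
  exact Finset.prod_pos fun l _ => hb l

/-- **DUAL ORTHOGONALITY**: at the `m + 1` distinct zeros `z_k` of `q_{m+1}`, `Σ_k q_i(z_k) · (c_j q_j(z_k)/K_k) = δ_{ij}` for `i, j ≤ m` (`c_j = b_{j+1} ⋯ b_m`, `K_k = Σ_j c_j q_j(z_k)²`) —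
rows orthonormal ⇒ columns orthonormal. [Golub–Welsch 1969 §2; Chihara I §6; this file, §1045] -/
theorem recurrence_dual_orthogonality {q : ℕ → ℝ[X]} {a b : ℕ → ℝ} (hq0 : q 0 = 1) (hq1 : q 1 = Polynomial.X - C (a 0))
    (hrec : ∀ n, q (n + 2) = (Polynomial.X - C (a (n + 1))) * q (n + 1) - C (b (n + 1)) * q n) (hb : ∀ j, 0 < b j) {m : ℕ} {z : Fin (m + 1) → ℝ}
    (hz : Function.Injective z) (hzr : ∀ k, (q (m + 1)).eval (z k) = 0) (i j : Fin (m + 1)) :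
    ∑ k, (q i).eval (z k) * ((∏ l ∈ Finset.Ico ((j : ℕ) + 1) (m + 1), b l) * (q j).eval (z k)
      / ∑ j' ∈ Finset.range (m + 1), (∏ l ∈ Finset.Ico (j' + 1) (m + 1), b l) * ((q j').eval (z k) * (q j').eval (z k))) = if i = j then 1 else 0 := by
  set K : Fin (m + 1) → ℝ := fun k => ∑ j' ∈ Finset.range (m + 1), (∏ l ∈ Finset.Ico (j' + 1) (m + 1), b l) * ((q j').eval (z k) * (q j').eval (z k)) with hK
  have hKpos : ∀ k, 0 < K k := fun k => recurrence_cd_diag_pos hq0 hb m (z k)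
  set B : Matrix (Fin (m + 1)) (Fin (m + 1)) ℝ := Matrix.of fun k j => (∏ l ∈ Finset.Ico ((j : ℕ) + 1) (m + 1), b l) * (q j).eval (z k) / K k with hB
  set Cm : Matrix (Fin (m + 1)) (Fin (m + 1)) ℝ := Matrix.of fun k j => (q j).eval (z k) with hCm
  -- `B Cᵀ = 1`
  have hBC : B * Cmᵀ = 1 := by
    ext k l
    rw [Matrix.mul_apply, Matrix.one_apply]
    simp only [hB, hCm, Matrix.of_apply, Matrix.transpose_apply]
    have hsum : ∑ x : Fin (m + 1), (∏ l' ∈ Finset.Ico ((x : ℕ) + 1) (m + 1), b l') * (q x).eval (z k) / K k * (q x).eval (z l)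
        = (∑ x ∈ Finset.range (m + 1), (∏ l' ∈ Finset.Ico (x + 1) (m + 1), b l') * ((q x).eval (z k) * (q x).eval (z l))) / K k := by
      rw [Finset.sum_div, ← Fin.sum_univ_eq_sum_range (fun x => (∏ l' ∈ Finset.Ico (x + 1) (m + 1), b l') * ((q x).eval (z k) * (q x).eval (z l)) / K k) (m + 1)]
      exact Finset.sum_congr rfl fun x _ => by ring
    rw [hsum]
    split_ifs with hkl
    · subst hkl; exact div_self (hKpos k).ne'
    · rw [recurrence_cd_offdiag_eq_zero hq0 hq1 hrec m (fun e => hkl (hz e)) (hzr k) (hzr l), zero_div]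
  -- hence `Cᵀ B = 1`
  have hCB : Cmᵀ * B = 1 := mul_eq_one_comm.1 hBC
  have h := congrFun (congrFun hCB i) j
  rw [Matrix.mul_apply, Matrix.one_apply] at h
  simp only [hB, hCm, Matrix.of_apply, Matrix.transpose_apply] at h
  exact h

/-- `b_1 ⋯ b_m = (b_1 ⋯ b_j) · (b_{j+1} ⋯ b_m)` for `j ≤ m`. [bookkeeping; this file, §1045] -/
theorem prod_Ico_one_div_prod_Ico_succ (b : ℕ → ℝ) {j m : ℕ} (hj : j ≤ m) :
    ∏ l ∈ Finset.Ico 1 (m + 1), b l = (∏ l ∈ Finset.Ico 1 (j + 1), b l) * ∏ l ∈ Finset.Ico (j + 1) (m + 1), b l :=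
  (Finset.prod_Ico_consecutive b (by omega) (by omega)).symm

/-- **THE FINITE FAVARD THEOREM.**  Let `q_0 = 1`, `q_1 = X − a_0`, `q_{n+2} = (X − a_{n+1}) q_{n+1} − b_{n+1} q_n` with every `b_j > 0`, and `m ∈ ℕ`.  Then there are `z_0 < ⋯ < z_m` — the zeros of
`q_{m+1}` — and weights `μ_k > 0` with `Σ_k μ_k = 1` such that `Σ_k μ_k q_i(z_k) q_j(z_k) = 0` for `i ≠ j ≤ m` and `Σ_k μ_k q_j(z_k)² = b_1 ⋯ b_j` for `j ≤ m`: the `q_j` are the monic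
orthogonal polynomials of the positive discrete measure `(μ, z)`. [Favard 1935; Chihara I Thm 4.4 + Thm 4.2 + (6.5); this file, §1045] -/
theorem favard_finite {q : ℕ → ℝ[X]} {a b : ℕ → ℝ} (hq0 : q 0 = 1) (hq1 : q 1 = Polynomial.X - C (a 0))
    (hrec : ∀ n, q (n + 2) = (Polynomial.X - C (a (n + 1))) * q (n + 1) - C (b (n + 1)) * q n) (hb : ∀ j, 0 < b j) (m : ℕ) :
    ∃ z μ : Fin (m + 1) → ℝ, StrictMono z ∧ (∀ k, (q (m + 1)).eval (z k) = 0) ∧ (∀ k, 0 < μ k) ∧ ∑ k, μ k = 1 ∧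
      ∀ i j : Fin (m + 1), ∑ k, μ k * ((q i).eval (z k) * (q j).eval (z k)) = if i = j then ∏ l ∈ Finset.Ico 1 ((j : ℕ) + 1), b l else 0 := by
  obtain ⟨z, hz, hzr, -⟩ := recurrence_zeros hq0 hq1 hrec hb m
  set K : Fin (m + 1) → ℝ := fun k => ∑ j' ∈ Finset.range (m + 1), (∏ l ∈ Finset.Ico (j' + 1) (m + 1), b l) * ((q j').eval (z k) * (q j').eval (z k)) with hK
  have hKpos : ∀ k, 0 < K k := fun k => recurrence_cd_diag_pos hq0 hb m (z k)
  set c0 : ℝ := ∏ l ∈ Finset.Ico 1 (m + 1), b l with hc0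
  have hc0pos : 0 < c0 := Finset.prod_pos fun l _ => hb l
  refine ⟨z, fun k => c0 / K k, hz, hzr, fun k => div_pos hc0pos (hKpos k), ?_, fun i j => ?_⟩
  · -- total mass: the case `i = j = 0` of dual orthogonality
    have h := recurrence_dual_orthogonality hq0 hq1 hrec hb hz.injective hzr 0 0
    rw [if_pos rfl] at h
    rw [← h]
    refine Finset.sum_congr rfl fun k _ => ?_
    have e0 : (q ((0 : Fin (m + 1)) : ℕ)).eval (z k) = 1 := by rw [Fin.val_zero, hq0, eval_one]
    rw [e0, one_mul, mul_one, Fin.val_zero, zero_add]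
  · have h := recurrence_dual_orthogonality hq0 hq1 hrec hb hz.injective hzr i j
    have hcj : c0 = (∏ l ∈ Finset.Ico 1 ((j : ℕ) + 1), b l) * ∏ l ∈ Finset.Ico ((j : ℕ) + 1) (m + 1), b l := prod_Ico_one_div_prod_Ico_succ b (Nat.lt_succ_iff.1 j.2)
    have hcjpos : 0 < ∏ l ∈ Finset.Ico ((j : ℕ) + 1) (m + 1), b l := Finset.prod_pos fun l _ => hb l
    -- `Σ_k (c0/K_k) q_i q_j = (b_1⋯b_j) · Σ_k q_i (c_j q_j / K_k)`
    have e : ∑ k, c0 / K k * ((q i).eval (z k) * (q j).eval (z k))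
        = (∏ l ∈ Finset.Ico 1 ((j : ℕ) + 1), b l) * ∑ k, (q i).eval (z k) * ((∏ l ∈ Finset.Ico ((j : ℕ) + 1) (m + 1), b l) * (q j).eval (z k) / K k) := by
      rw [Finset.mul_sum]
      refine Finset.sum_congr rfl fun k _ => ?_
      rw [hcj]
      ring
    rw [e, h]
    split_ifs <;> simp

end Summit.Ventures.HSemireg.Wedge.HankelOuter
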